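import Mathlib.RingTheory.Nilpotent.Exp
import Mathlib.RingTheory.Nilpotent.Lemmas
import Mathlib.Algebra.Module.Injective
import Mathlib.Algebra.Module.CharacterModule
import Literature.NumberTheory.Automorphic.NilpotentExpRootHom
import Literature.NumberTheory.Automorphic.LieAlgebraGL
import HarnessLib

/-!
# Adjoint exponentials, tangents of exponential curves, and lattice functionals

Trunk T-AUTOMORPHIC (G25 AutomorphicL); three groups of auxiliary results for the computation of
the Lie algebra of the group `⟨T_X, exp (x E_α)⟩` of Chevalley's existence theorem
(`Literature.NumberTheory.Automorphic.chevalley_existence`, Springer, *Linear Algebraic Groups*,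
2nd ed., 10.1.1, 10.2.8), in the `k`-points vocabulary of `LinearAlgebraicGroups.lean`,
`LieAlgebraGL.lean` (`lieAlgebraGL`, `coeffOneMatrix_mem_lieAlgebraGL`) and
`NilpotentExpRootHom.lean` (`expHom A hA : x ↦ exp (x A)`). Everything is proved.

* **`Ad (exp B) = exp (ad B)`** (`exp_mul_mul_exp_neg_eq_sum`, Springer 4.4.15 / 10.2.8: the
  elements `exp (x ad e_α)` are automorphisms): for a nilpotent matrix `B`,
  `exp (B) M exp (-B) = ∑_i (ad B)^i (M) / i!`, proved in the algebra of linear operators on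
  `𝔤𝔩ₙ` from `exp (L_B - R_B) = exp (L_B) exp (-R_B)` (Mathlib `IsNilpotent.exp_add_of_commute`)
  and `exp (L_B) = L_{exp B}`, `exp (R_B) = R_{exp B}`; hence **a subspace of `𝔤𝔩ₙ` stable under
  `ad B` is stable under `Ad (exp B)`** (`exp_mul_mul_exp_neg_mem`).
* **The velocity of `x ↦ exp (x A)` is `A`** (`mem_lieAlgebraGL_of_expHom_mem`, Springer 4.4.15
  (1): `L(U_α) = k X_α`): if `exp (x A) ∈ G` for all `x` then `A ∈ Lie(G)`
  (`coeffOneMatrix_mem_lieAlgebraGL` applied to the polynomial curve `exp (x A) = ∑ xⁱ Aⁱ / i!`).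
* **Functionals on a lattice** (`X` an abelian group, free where points are separated, `k` of
  characteristic `0`): coordinates separate points (`exists_addMonoidHom_apply_ne_zero`,
  `exists_addMonoidHom_apply_ne`), and **prescribing values on a finite family subject to its
  integer relations** (`exists_addMonoidHom_apply_eq_of_relations`): if `τ : I → k` kills every
  integer relation among `u : I → X` then `τ_i = f (u_i)` for some `f ∈ Hom(X, k)` — define `f` on
  the subgroup generated by the `u_i` by lifting, and extend to `X` by injectivity of `k` as a
  `ℤ`-module (Baer's criterion).

## Mathlib

`IsNilpotent.exp` (`exp_eq_sum`, `exp_add_of_commute`, `map_exp`), `Algebra.lmul`,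
`LinearMap.mul`, `Commute.isNilpotent_sub`, `map_rat_smul`, `Rat.cast_smul_eq_qsmul`,
`Module.Free.chooseBasis`, `Module.Baer.of_divisible`, `Fintype.linearCombination` (the relation
map `m ↦ ∑ m_i u_i`),
`AddMonoidHom.liftOfSurjective`. Nothing here duplicates a Mathlib declaration (Mathlib has no
`Ad ∘ exp = exp ∘ ad` for matrices; `LieDerivation.exp` material concerns abstract derivations).

## References

* [SpringerLAG1998] T. A. Springer, *Linear Algebraic Groups*, 2nd ed. (1998): 4.4.15, 10.1.1,
  10.2.8.
-/

noncomputable section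

open scoped MatrixGroups

namespace Literature.NumberTheory.Automorphic

variable {k : Type*} [Field k]

/-! ### `Ad (exp B) = exp (ad B)` on `𝔤𝔩ₙ` -/

section AdExp

variable {n : Type*} [Fintype n] [DecidableEq n]

/-- The operator `ad B = L_B - R_B` on `𝔤𝔩ₙ`: `M ↦ B M - M B`, written with Mathlib's
`LinearMap.mulLeft` / `LinearMap.mulRight`. Under Mathlib's *local* instance
`LieRing.ofAssociativeRing` this is `LieAlgebra.ad k (Matrix n n k) B`
(`LieAlgebra.ad_eq_lmul_left_sub_lmul_right`); since that instance is local we keep a standalone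
definition. [folklore] -/
def adOp (B : Matrix n n k) : Module.End k (Matrix n n k) :=
  LinearMap.mulLeft k B - LinearMap.mulRight k B

/-- Unfolding of `adOp`. [folklore] -/
@[simp] lemma adOp_apply (B M : Matrix n n k) : adOp B M = B * M - M * B := by
  simp [adOp]

variable [CharZero k]

/-- **`exp (L_B) = L_{exp B}`** for nilpotent `B`. [folklore] -/
lemma exp_mulLeft_eq {B : Matrix n n k} (hB : IsNilpotent B) :
    IsNilpotent.exp (LinearMap.mulLeft k B) = LinearMap.mulLeft k (IsNilpotent.exp B) := by
  have h := IsNilpotent.map_exp hB (Algebra.lmul k (Matrix n n k))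
  exact h.symm

/-- **`exp (R_B) = R_{exp B}`** for nilpotent `B`. [folklore] -/
lemma exp_mulRight_eq {B : Matrix n n k} (hB : IsNilpotent B) :
    IsNilpotent.exp (LinearMap.mulRight k B) = LinearMap.mulRight k (IsNilpotent.exp B) := by
  obtain ⟨N, hN⟩ := hB
  have hRN : (LinearMap.mulRight k B : Module.End k (Matrix n n k)) ^ N = 0 := by
    rw [LinearMap.pow_mulRight, hN]; ext; simp
  refine LinearMap.ext fun M => ?_
  rw [IsNilpotent.exp_eq_sum hRN, IsNilpotent.exp_eq_sum hN, LinearMap.sum_apply,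
    LinearMap.mulRight_apply, Finset.mul_sum]
  refine Finset.sum_congr rfl fun i _ => ?_
  rw [LinearMap.smul_apply, LinearMap.pow_mulRight, LinearMap.mulRight_apply, Matrix.mul_smul]

omit [CharZero k] in
/-- `ad B` is nilpotent for nilpotent `B`. [folklore] -/
lemma isNilpotent_adOp {B : Matrix n n k} (hB : IsNilpotent B) : IsNilpotent (adOp B) :=
  (LinearMap.commute_mulLeft_right B B).isNilpotent_sub ((LinearMap.isNilpotent_mulLeft_iff k B).2 hB)
    ((LinearMap.isNilpotent_mulRight_iff k B).2 hB)

/-- **`Ad (exp B) = exp (ad B)`**: `exp (B) M exp (-B) = exp (ad B) (M)` for nilpotent `B`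
(Springer 4.4.15; `exp (L_B - R_B) = exp (L_B) exp (-R_B)` for the commuting nilpotent operators
`L_B`, `R_B`). [folklore] -/
theorem exp_mul_mul_exp_neg_eq {B : Matrix n n k} (hB : IsNilpotent B) (M : Matrix n n k) :
    IsNilpotent.exp B * M * IsNilpotent.exp (-B) = IsNilpotent.exp (adOp B) M := by
  have hsplit : adOp B = LinearMap.mulLeft k B + LinearMap.mulRight k (-B) := by
    have : (LinearMap.mulRight k (-B) : Module.End k (Matrix n n k)) = -LinearMap.mulRight k B := by
      ext M; simp
    rw [adOp, this, sub_eq_add_neg]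
  rw [hsplit, IsNilpotent.exp_add_of_commute (LinearMap.commute_mulLeft_right B (-B))
    ((LinearMap.isNilpotent_mulLeft_iff k B).2 hB) ((LinearMap.isNilpotent_mulRight_iff k (-B)).2 hB.neg),
    Module.End.mul_apply, exp_mulRight_eq hB.neg, exp_mulLeft_eq hB]
  simp [mul_assoc]

/-- `exp (ad B) M` lies in every subspace containing `M` and stable under `ad B`. [folklore] -/
lemma exp_adOp_mem {L : Submodule k (Matrix n n k)} {B : Matrix n n k} (hB : IsNilpotent B)
    (hL : ∀ M ∈ L, B * M - M * B ∈ L) {M : Matrix n n k} (hM : M ∈ L) :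
    IsNilpotent.exp (adOp B) M ∈ L := by
  obtain ⟨N, hN⟩ := isNilpotent_adOp hB
  rw [IsNilpotent.exp_eq_sum hN, LinearMap.sum_apply]
  refine Submodule.sum_mem _ fun i _ => ?_
  rw [LinearMap.smul_apply, ← Rat.cast_smul_eq_qsmul (R := k)]
  refine Submodule.smul_mem _ _ ?_
  clear! N
  induction i with
  | zero => simpa using hM
  | succ i ih =>
    rw [pow_succ', Module.End.mul_apply, adOp_apply]
    exact hL _ ih

/-- **A subspace of `𝔤𝔩ₙ` stable under `ad B` is stable under conjugation by `exp B`** (`B`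
nilpotent): `exp (B) M exp (-B) ∈ L` for `M ∈ L` (Springer 10.2.8: the `exp (x ad e_α)` preserve
`𝔤`). [folklore] -/
theorem exp_mul_mul_exp_neg_mem {L : Submodule k (Matrix n n k)} {B : Matrix n n k}
    (hB : IsNilpotent B) (hL : ∀ M ∈ L, B * M - M * B ∈ L) {M : Matrix n n k} (hM : M ∈ L) :
    IsNilpotent.exp B * M * IsNilpotent.exp (-B) ∈ L := by
  rw [exp_mul_mul_exp_neg_eq hB]
  exact exp_adOp_mem hB hL hM

/-- The same for the one-parameter group: `exp (x B) M exp (x B)⁻¹ ∈ L`, in the form used with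
`lie_mem_of_forall_conj_mem`. [folklore] -/
theorem expHom_conj_mem {L : Submodule k (Matrix n n k)} {B : Matrix n n k} (hB : IsNilpotent B)
    (hL : ∀ M ∈ L, B * M - M * B ∈ L) {M : Matrix n n k} (hM : M ∈ L) (x : Multiplicative k) :
    ((expHom B hB x : GL n k) : Matrix n n k) * M *
        (((expHom B hB x)⁻¹ : GL n k) : Matrix n n k) ∈ L := by
  rw [← map_inv, coe_expHom_apply, coe_expHom_apply, toAdd_inv, neg_smul]
  refine exp_mul_mul_exp_neg_mem (hB.smul _) (fun M' hM' => ?_) hM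
  rw [Matrix.smul_mul, Matrix.mul_smul, ← smul_sub]
  exact L.smul_mem _ (hL M' hM')

end AdExp

/-! ### The velocity of `x ↦ exp (x A)` -/

section ExpTangent

variable [CharZero k] {n : Type*} [Fintype n] [DecidableEq n]

/-- **`A ∈ Lie(G)` if `exp (x A) ∈ G` for all `x`** (`A` nilpotent): the curve `x ↦ exp (x A)`
has polynomial coordinates `∑ xⁱ (Aⁱ)_{ab} / i!` with linear coefficients `A_{ab}`
(Springer 4.4.15 (1): the Lie algebra of `U_α = {exp (x X_α)}` is `k X_α`). [folklore] -/
theorem mem_lieAlgebraGL_of_expHom_mem {A : Matrix n n k} (hA : IsNilpotent A)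
    {G : Subgroup (GL n k)} (hG : ∀ x, expHom A hA x ∈ G) : A ∈ lieAlgebraGL G := by
  obtain ⟨N₀, hN₀⟩ := id hA
  -- a vanishing power of exponent at least `2`
  set N := N₀ + 2 with hNdef
  have hN : A ^ N = 0 := by rw [hNdef, pow_add, hN₀, zero_mul]
  let P : GLCoord n → Polynomial k := Sum.elim
    (fun ab => ∑ i ∈ Finset.range N, Polynomial.C (((i.factorial : k)⁻¹ • A ^ i) ab.1 ab.2) *
      Polynomial.X ^ i) (fun _ => Polynomial.C 1)
  have hP : ∀ (x : k) (c : GLCoord n), glCoordFun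
      (((⟨expHom A hA (Multiplicative.ofAdd x), hG _⟩ : ↥G) : GL n k)) c = (P c).eval x := by
    intro x c
    rcases c with ⟨a, b⟩ | ⟨⟩
    · simp only [glCoordFun_inl, coe_expHom_apply, toAdd_ofAdd, P, Sum.elim_inl]
      exact exp_smul_apply_eq_eval hN x a b
    · simp only [glCoordFun_inr, coe_expHom_apply, toAdd_ofAdd, P, Sum.elim_inr,
        Polynomial.eval_C, det_exp_smul hA x, inv_one]
  have h0 : (⟨expHom A hA (Multiplicative.ofAdd 0), hG _⟩ : ↥G) = 1 := by
    apply Subtype.ext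
    change expHom A hA (Multiplicative.ofAdd 0) = 1
    rw [ofAdd_zero, map_one]
  have hmem := coeffOneMatrix_mem_lieAlgebraGL (G := G)
    (fun x => ⟨expHom A hA (Multiplicative.ofAdd x), hG _⟩) P hP h0
  convert hmem using 1
  ext a b
  simp only [Matrix.of_apply, P, Sum.elim_inl, Polynomial.finsetSum_coeff,
    Polynomial.coeff_C_mul, Polynomial.coeff_X_pow]
  rw [Finset.sum_eq_single 1 (fun i _ hi => by rw [if_neg (Ne.symm hi), mul_zero]) (fun h => by
    exfalso; exact h (Finset.mem_range.2 (by omega)))]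
  simp

end ExpTangent

/-! ### Functionals on a lattice -/

section Lattice

variable {X : Type*} [AddCommGroup X]

/-- **Coordinates separate points**: for `x ≠ 0` in a free abelian group there is
`ℓ ∈ Hom(X, k)` (`k` of characteristic `0`) with `ℓ x ≠ 0` — an integer coordinate of `x` in a
ℤ-basis, cast to `k`. [folklore] -/
theorem exists_addMonoidHom_apply_ne_zero [Module.Free ℤ X] [CharZero k] {x : X} (hx : x ≠ 0) :
    ∃ ℓ : X →+ k, ℓ x ≠ 0 := by
  let bX := Module.Free.chooseBasis ℤ X
  obtain ⟨i, hi⟩ : ∃ i, bX.repr x i ≠ 0 := by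
    by_contra hcon
    push Not at hcon
    exact hx (bX.repr.injective (by ext i; simpa using hcon i))
  refine ⟨(Int.castAddHom k).comp (bX.coord i).toAddMonoidHom, ?_⟩
  simpa using hi

/-- Distinct lattice points are separated by some `ℓ ∈ Hom(X, k)`. [folklore] -/
theorem exists_addMonoidHom_apply_ne [Module.Free ℤ X] [CharZero k] {x y : X} (hxy : x ≠ y) :
    ∃ ℓ : X →+ k, ℓ x ≠ ℓ y := by
  obtain ⟨ℓ, hℓ⟩ := exists_addMonoidHom_apply_ne_zero (k := k) (sub_ne_zero.2 hxy)
  exact ⟨ℓ, fun h => hℓ (by rw [map_sub, h, sub_self])⟩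

/-- **Extending an additive map from a subgroup to a field of characteristic `0`**: every
`g : X' → k` on a subgroup `X' ≤ X` of an abelian group extends to `X` (`k` is a `ℚ`-vector space,
hence an injective `ℤ`-module: Baer's criterion, Mathlib `Module.Baer.of_divisible`; cf.
`Literature.NumberTheory.EllipticCurves.exists_addMonoidHom_comp_subtype_eq`, the same fact in
another trunk). [folklore] -/
theorem exists_addMonoidHom_extend [CharZero k] (X' : AddSubgroup X) (g : X' →+ k) :
    ∃ F : X →+ k, ∀ x : X', F x = g x := by
  obtain ⟨F, hF⟩ := (Module.Baer.of_divisible k).extension_property_addMonoidHom X'.subtype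
    X'.subtype_injective g
  exact ⟨F, fun x => DFunLike.congr_fun hF x⟩

/-- **Prescribing the values of a functional on a finite family, subject to its integer
relations.** If `τ : I → k` satisfies `∑ m_i τ_i = 0` for every integer relation
`∑ m_i u_i = 0` among `u : I → X` (`X` any abelian group, `k` of characteristic `0`), then there
is `f ∈ Hom(X, k)` with `f (u_i) = τ_i` for all `i`. [folklore] -/
theorem exists_addMonoidHom_apply_eq_of_relations [CharZero k] {I : Type*} [Fintype I]
    (u : I → X) (τ : I → k)
    (hτ : ∀ m : I → ℤ, ∑ i, m i • u i = 0 → ∑ i, (m i : k) * τ i = 0) :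
    ∃ f : X →+ k, ∀ i, f (u i) = τ i := by
  classical
  -- `τ` as a map on exponent vectors, killing the relations
  let ψ : (I → ℤ) →+ k :=
    { toFun := fun m => ∑ i, (m i : k) * τ i
      map_zero' := by simp
      map_add' := fun m m' => by
        simp only [Pi.add_apply, Int.cast_add, add_mul, Finset.sum_add_distrib] }
  -- the relation map `m ↦ ∑ m_i u_i` (Mathlib `Fintype.linearCombination`)
  let ρ : (I → ℤ) →+ X := (Fintype.linearCombination ℤ u).toAddMonoidHom
  have hρ : ∀ m, ρ m = ∑ i, m i • u i := fun m => Fintype.linearCombination_apply ℤ u m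
  have hψ : ρ.ker ≤ ψ.ker := fun m hm =>
    (AddMonoidHom.mem_ker).2 (hτ m (by rw [← hρ]; exact (AddMonoidHom.mem_ker).1 hm))
  -- the subgroup generated by the family and the lifted map on it
  let X' : AddSubgroup X := ρ.range
  let A : (I → ℤ) →+ X' := ρ.rangeRestrict
  have hA : Function.Surjective A := AddMonoidHom.rangeRestrict_surjective _
  have hAker : A.ker = ρ.ker := AddMonoidHom.ker_rangeRestrict _
  let g : X' →+ k := A.liftOfSurjective hA ⟨ψ, by rw [hAker]; exact hψ⟩
  have hg : ∀ m, g (A m) = ψ m := fun m =>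
    AddMonoidHom.liftOfRightInverse_comp_apply A (Function.surjInv hA)
      (Function.rightInverse_surjInv hA) ⟨ψ, by rw [hAker]; exact hψ⟩ m
  obtain ⟨F, hF⟩ := exists_addMonoidHom_extend (k := k) X' g
  refine ⟨F, fun i => ?_⟩
  have hAi : ((A (Pi.single i 1) : X') : X) = u i := by
    change ρ (Pi.single i 1) = u i
    change Fintype.linearCombination ℤ u (Pi.single i 1) = u i
    rw [Fintype.linearCombination_apply_single, one_smul]
  rw [← hAi, hF, hg]
  change ∑ j, ((Pi.single i (1 : ℤ) : I → ℤ) j : k) * τ j = τ i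
  rw [Finset.sum_eq_single i (fun j _ hj => by simp [Pi.single_eq_of_ne hj]) (by simp)]
  simp

end Lattice

end Literature.NumberTheory.Automorphic
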